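import Summits.HodgeConjecture.HodgeConjecture.Theorems.Ring2AbelianAllAndreTwistedProductRows
import HarnessLib

/-!
# Ring 2 · sub-cell AbelianAll (ALL ABELIAN VARIETIES), André axis, part XLVIII-d — THE HABITAT FORM: when `K` acts on the pencil, a global class
# that is a Weil `E±`-class on ONE member is one on EVERY member, so the row of part XLVIII-c needs Weil data at the charted point `t` only

HONEST FRAMING (page 1, verbatim): **research route, not a corollary; conditional on HC_CM plus one named
minimal statement.** Cell line: research route conditional on HC_CM; not a corollary; Q11.4-sentence-2
already refuted in dim ≥ 3. Nothing in this file proves a case of the Hodge conjecture or of `B(X)` for a named `X`: every row is an IMPLICATION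
with displayed hypotheses; `HC_CM`, `HC_AV` and the global nodes do NOT occur. Inputs of the row: algebraic Weil planes of the twisted products of
members (HYPOTHESIS; Weil-HC for `4n`-folds, OPEN) and Verdier (`hGT`, NAMED-FACT BINDER). Item `Theses.RankFourFaces.CMToAbelian` (stmt-16267)
stays OPEN; N104 untouched; no node is born (0 `def`, 0 `sorry`). Seat `pub-hodge-ring2-ab-andre-2`, gen 40 (part XLVIII).

## Content (theorems only; standard axioms)

* §1 **`map_chart_fiberι_mem_weilClassesPlus_of_at`** / **`…Minus_of_at`** — `K` acts on the pencil by `S`-endomorphisms: `Ψ x y : 𝒳 ⟶ 𝒳`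
  (`x, y ∈ ℕ`) restricting on the members `X_s`, `X_t` to endomorphisms charted by the test endomorphisms `x𝟙 + yφ_s`, `x𝟙 + yφ_t` of abelian
  varieties `A_s ≅ X_s`, `A_t ≅ X_t`. THEN a global class `U` with `e_t^*(j_t^* U) ∈ E₊(A_t, φ_t)` has `e_s^*(j_s^* U) ∈ E₊(A_s, φ_s)` (and `E₋`
  likewise): `(Ψ x y)^* U − χ(x, y) U ∈ ker j_t^* = ker j_s^*` (part XVII `ker_map_fiberι_eq`, Deligne's theorem of the fixed part on the carriers).
* §2 **`betaInverse_of_weilPlanes_twistedProd_of_KAction_of_verdier`** — part XLVIII-c §2 with the per-member Weil-line hypotheses `hUp`, `hUm`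
  DISCHARGED from the `K`-action and the Weil data at the ONE charted point `t`: on a compact pencil of abelian `2n`-folds on which `K = ℚ(√−d_K)`
  acts, with `I_t^{2n} = ℂθ_t ⊕ ℂu₊(t) ⊕ ℂu₋(t)` (θ-line + the two Weil lines of `(A_t, φ_t)`) and a dual triple, **β at `t` in the middle degree ⟸
  the Weil planes of the twisted products `(A_s × A_t, Φ_s)` are algebraic for uncountably many `s`, + Verdier**.

## Honest status

Bookkeeping that removes hypotheses, not strength: the `K`-action (`Ψ`, its fibre restrictions and charts) is DATA; in print it is the
imaginary-quadratic field acting on the universal family over a Shimura curve / on a Mumford–Tate pencil of Weil type. The open input is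
unchanged (part XLVIII-c): Weil-HC for the split-type twisted products `X_s × X̄_t` on uncountably many members. Nothing minimal is claimed; N104
untouched. EDGE LABELS: K (§1), K[Weil planes of twisted products, Verdier] (§2).
References: vanGeemen1994HodgeAV (4.8–4.9, Lemma 5.2); DeligneHodgeII1971 (Thm. 4.1.1, Cor. 4.2.8); Tankeev2003 (Thm. 10.1); Verdier1976 (Cor. (5.1));
Schoen1998HodgeWeilAddendum (§10).
-/

noncomputable section

set_option linter.dupNamespace false

namespace Summit.HodgeConjecture.HodgeConjecture.Ring2.AbelianAll

open CategoryTheory CategoryTheory.Limits AlgebraicGeometry MonoidalCategory CartesianMonoidalCategory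
open Literature.AlgebraicGeometry Literature.AlgebraicGeometry.Motives
open Literature.AlgebraicGeometry.HodgeTheory
open Literature.AlgebraicTopology.SingularHomology (singularCohomology cupProduct cupProduct_map)
open Summit.HodgeConjecture.HodgeConjecture.Theorems (deg_fiberGysin_aux)

/-! ## §1 Weil lines of every member from Weil data at one member and the `K`-action -/

section EveryMember

variable {𝒳 S : SchemeOver ℂ} {d : ℕ} {f : 𝒳 ⟶ S} (hf : IsCompactAbelianPencil f d)

/-- `𝐣[s, k]` — `j_s^*` as a linear map (display notation). [cite: VoisinHodgeI2002, §7.3.2] -/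
local notation3 (prettyPrint := false) "𝐣[" s ", " k "]" => (complexBetti.map (fiberι f s) k).hom

include hf in
/-- **A GLOBAL CLASS WHICH IS A WEIL `E₊`-CLASS ON ONE MEMBER IS ONE ON EVERY MEMBER**, when `K` acts on the pencil: `Ψ x y : 𝒳 ⟶ 𝒳` over `S`
(`x, y ∈ ℕ`) restricting on the charted members `A_s ≅ X_s`, `A_t ≅ X_t` to the test endomorphisms `x𝟙 + yφ`. If `e_t^*(j_t^* U) ∈ E₊(A_t, φ_t)` then
`e_s^*(j_s^* U) ∈ E₊(A_s, φ_s)`: `(Ψ x y)^* U − χ(x,y) U ∈ ker j_t^* = ker j_s^*` (part XVII `ker_map_fiberι_eq`). [cite: vanGeemen1994HodgeAV, 4.9]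
[cite: DeligneHodgeII1971, Thm. 4.1.1] -/
theorem map_chart_fiberι_mem_weilClassesPlus_of_at (s t : ComplexPoints S) {n dK : ℕ} (Ψ : ℕ → ℕ → (𝒳 ⟶ 𝒳))
    (Ψs Ψt : ℕ → ℕ → _) (hΨs : ∀ x y, (Ψs x y : fiberOver f s ⟶ fiberOver f s) ≫ fiberι f s = fiberι f s ≫ Ψ x y)
    (hΨt : ∀ x y, (Ψt x y : fiberOver f t ⟶ fiberOver f t) ≫ fiberι f t = fiberι f t ≫ Ψ x y)
    (As At : AbelianVariety ℂ) (es : As.X ≅ fiberOver f s) (et : At.X ≅ fiberOver f t) (φs : As ⟶ As) (φt : At ⟶ At)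
    (hes : ∀ x y, es.hom ≫ Ψs x y = (x • 𝟙 As + y • φs).hom.hom.hom ≫ es.hom) (het : ∀ x y, et.hom ≫ Ψt x y = (x • 𝟙 At + y • φt).hom.hom.hom ≫ et.hom)
    (U : complexBetti 𝒳 (2 * n)) (hU : complexBetti.map et.hom (2 * n) (𝐣[t, 2 * n] U) ∈ weilClassesPlus At φt n dK) :
    complexBetti.map es.hom (2 * n) (𝐣[s, 2 * n] U) ∈ weilClassesPlus As φs n dK := by
  rw [mem_weilClassesPlus_iff] at hU ⊢
  intro x y
  set χ : ℂ := ((x : ℂ) + (y : ℂ) * Complex.I * (Real.sqrt dK : ℂ)) ^ (2 * n) with hχ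
  -- `(Ψ x y)^* U − χ U ∈ ker j_t^*`
  have ht : 𝐣[t, 2 * n] ((complexBetti.map (Ψ x y) (2 * n)).hom U - χ • U) = 0 := by
    have h1 : 𝐣[t, 2 * n] ((complexBetti.map (Ψ x y) (2 * n)).hom U) = (complexBetti.map (Ψt x y) (2 * n)).hom (𝐣[t, 2 * n] U) := by
      rw [← complexBetti.map_comp_apply, ← hΨt x y, complexBetti.map_comp_apply]
    -- apply the injective `e_t^*`
    have het' : (complexBetti.map et.hom (2 * n)).hom ((complexBetti.map (Ψt x y) (2 * n)).hom (𝐣[t, 2 * n] U)) =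
        χ • (complexBetti.map et.hom (2 * n)).hom (𝐣[t, 2 * n] U) := by
      rw [← complexBetti.map_comp_apply, het x y, complexBetti.map_comp_apply]
      exact hU x y
    rw [map_sub, map_smul, h1]
    have hinj : Function.Injective (complexBetti.map et.hom (2 * n)).hom := fun a b hab ↦ by
      have := congrArg (complexBetti.map et.inv (2 * n)).hom hab
      rwa [← complexBetti.map_comp_apply, ← complexBetti.map_comp_apply, et.inv_hom_id, complexBetti.map_id] at this
    apply hinj
    rw [map_sub, map_smul, map_zero]
    exact sub_eq_zero.2 het'
  -- hence `∈ ker j_s^*`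
  have hs : 𝐣[s, 2 * n] ((complexBetti.map (Ψ x y) (2 * n)).hom U - χ • U) = 0 := by
    have hmem : (complexBetti.map (Ψ x y) (2 * n)).hom U - χ • U ∈ LinearMap.ker 𝐣[t, 2 * n] := LinearMap.mem_ker.2 ht
    rw [← ker_map_fiberι_eq hf (2 * n) s t] at hmem
    exact LinearMap.mem_ker.1 hmem
  rw [map_sub, map_smul, sub_eq_zero] at hs
  have h2 : 𝐣[s, 2 * n] ((complexBetti.map (Ψ x y) (2 * n)).hom U) = (complexBetti.map (Ψs x y) (2 * n)).hom (𝐣[s, 2 * n] U) := by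
    rw [← complexBetti.map_comp_apply, ← hΨs x y, complexBetti.map_comp_apply]
  rw [h2] at hs
  change (complexBetti.map (x • 𝟙 As + y • φs).hom.hom.hom (2 * n)).hom ((complexBetti.map es.hom (2 * n)).hom (𝐣[s, 2 * n] U)) = _
  rw [← complexBetti.map_comp_apply, ← hes x y, complexBetti.map_comp_apply]
  change (complexBetti.map es.hom (2 * n)).hom ((complexBetti.map (Ψs x y) (2 * n)).hom (𝐣[s, 2 * n] U)) = _
  rw [hs, map_smul]

include hf in
/-- **… and the same for the Weil line `E₋`.** [cite: vanGeemen1994HodgeAV, 4.9] [cite: DeligneHodgeII1971, Thm. 4.1.1] -/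
theorem map_chart_fiberι_mem_weilClassesMinus_of_at (s t : ComplexPoints S) {n dK : ℕ} (Ψ : ℕ → ℕ → (𝒳 ⟶ 𝒳))
    (Ψs Ψt : ℕ → ℕ → _) (hΨs : ∀ x y, (Ψs x y : fiberOver f s ⟶ fiberOver f s) ≫ fiberι f s = fiberι f s ≫ Ψ x y)
    (hΨt : ∀ x y, (Ψt x y : fiberOver f t ⟶ fiberOver f t) ≫ fiberι f t = fiberι f t ≫ Ψ x y)
    (As At : AbelianVariety ℂ) (es : As.X ≅ fiberOver f s) (et : At.X ≅ fiberOver f t) (φs : As ⟶ As) (φt : At ⟶ At)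
    (hes : ∀ x y, es.hom ≫ Ψs x y = (x • 𝟙 As + y • φs).hom.hom.hom ≫ es.hom) (het : ∀ x y, et.hom ≫ Ψt x y = (x • 𝟙 At + y • φt).hom.hom.hom ≫ et.hom)
    (U : complexBetti 𝒳 (2 * n)) (hU : complexBetti.map et.hom (2 * n) (𝐣[t, 2 * n] U) ∈ weilClassesMinus At φt n dK) :
    complexBetti.map es.hom (2 * n) (𝐣[s, 2 * n] U) ∈ weilClassesMinus As φs n dK := by
  rw [mem_weilClassesMinus_iff] at hU ⊢
  intro x y
  set χ : ℂ := ((x : ℂ) - (y : ℂ) * Complex.I * (Real.sqrt dK : ℂ)) ^ (2 * n) with hχ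
  have ht : 𝐣[t, 2 * n] ((complexBetti.map (Ψ x y) (2 * n)).hom U - χ • U) = 0 := by
    have h1 : 𝐣[t, 2 * n] ((complexBetti.map (Ψ x y) (2 * n)).hom U) = (complexBetti.map (Ψt x y) (2 * n)).hom (𝐣[t, 2 * n] U) := by
      rw [← complexBetti.map_comp_apply, ← hΨt x y, complexBetti.map_comp_apply]
    have het' : (complexBetti.map et.hom (2 * n)).hom ((complexBetti.map (Ψt x y) (2 * n)).hom (𝐣[t, 2 * n] U)) =
        χ • (complexBetti.map et.hom (2 * n)).hom (𝐣[t, 2 * n] U) := by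
      rw [← complexBetti.map_comp_apply, het x y, complexBetti.map_comp_apply]
      exact hU x y
    rw [map_sub, map_smul, h1]
    have hinj : Function.Injective (complexBetti.map et.hom (2 * n)).hom := fun a b hab ↦ by
      have := congrArg (complexBetti.map et.inv (2 * n)).hom hab
      rwa [← complexBetti.map_comp_apply, ← complexBetti.map_comp_apply, et.inv_hom_id, complexBetti.map_id] at this
    apply hinj
    rw [map_sub, map_smul, map_zero]
    exact sub_eq_zero.2 het'
  have hs : 𝐣[s, 2 * n] ((complexBetti.map (Ψ x y) (2 * n)).hom U - χ • U) = 0 := by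
    have hmem : (complexBetti.map (Ψ x y) (2 * n)).hom U - χ • U ∈ LinearMap.ker 𝐣[t, 2 * n] := LinearMap.mem_ker.2 ht
    rw [← ker_map_fiberι_eq hf (2 * n) s t] at hmem
    exact LinearMap.mem_ker.1 hmem
  rw [map_sub, map_smul, sub_eq_zero] at hs
  have h2 : 𝐣[s, 2 * n] ((complexBetti.map (Ψ x y) (2 * n)).hom U) = (complexBetti.map (Ψs x y) (2 * n)).hom (𝐣[s, 2 * n] U) := by
    rw [← complexBetti.map_comp_apply, ← hΨs x y, complexBetti.map_comp_apply]
  rw [h2] at hs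
  change (complexBetti.map (x • 𝟙 As + y • φs).hom.hom.hom (2 * n)).hom ((complexBetti.map es.hom (2 * n)).hom (𝐣[s, 2 * n] U)) = _
  rw [← complexBetti.map_comp_apply, ← hes x y, complexBetti.map_comp_apply]
  change (complexBetti.map es.hom (2 * n)).hom ((complexBetti.map (Ψs x y) (2 * n)).hom (𝐣[s, 2 * n] U)) = _
  rw [hs, map_smul]

end EveryMember

/-! ## §2 The row of part XLVIII-c in habitat form -/

section Habitat

variable {𝒳 S : SchemeOver ℂ} {d : ℕ} {f : 𝒳 ⟶ S} (hf : IsCompactAbelianPencil f d)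

/-- `𝐆[hf, s, k]` — `j_{s*}` for the complex orientations (display notation, as in part XL-a). [cite: FultonYoungTableaux1997, Appendix B §B.1 (5)] -/
local notation3 (prettyPrint := false) "𝐆[" hf ", " s ", " k "]" =>
  complexGysin complexOrientationFamily (IsCompactAbelianPencil.isSmoothProjective_fiberOver hf s)
    (IsCompactAbelianPencil.isSmoothProjective_total hf) (fiberι f s) (deg_fiberGysin_aux k d)

/-- `𝐣[s, k]` — `j_s^*` as a linear map (display notation). [cite: VoisinHodgeI2002, §7.3.2] -/
local notation3 (prettyPrint := false) "𝐣[" s ", " k "]" => (complexBetti.map (fiberι f s) k).hom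

/-- `∫[hf, t]` — the canonical complex trace of the fibre `X_t` (display notation for the tree's `traceC`). [cite: HatcherAT2002, §3.3 p. 241] -/
local notation3 (prettyPrint := false) "∫[" hf ", " t "]" => traceC (IsCompactAbelianPencil.isSmoothProjective_fiberOver hf t)

/-- **β IN THE MIDDLE DEGREE FROM THE WEIL PLANES OF THE TWISTED PRODUCTS — HABITAT FORM.** A compact pencil of abelian `2n`-folds on which
`K = ℚ(√−d_K)` acts by `S`-endomorphisms `Ψ x y` (`x, y ∈ ℕ`; fibre restrictions `Ψ_s x y` charted by `x𝟙 + yφ_s` on abelian varieties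
`A_s ≅ X_s` with `φ_s² = −d_K`, `d_K ≥ 1`), twisted endomorphisms `Φ_s` of `A_s × A_t` compatible with `φ_s`, `−φ_t`; global `Θ, U₊, U₋, Θ', U'₋, U'₊`
with `θ_s = j_s^*Θ` algebraic on every member, `θ'_t` algebraic, `e_t^* u±(t) ∈ E±(A_t, φ_t)`, `e_t^* u'∓(t) ∈ E∓(A_t, φ_t)` — WEIL DATA AT `t` ONLY —,
the dual-triple pairings and the span `I_t^{2n} = ℂθ_t + ℂu₊(t) + ℂu₋(t)`. IF the Weil plane of `(A_s × A_t, Φ_s)` is algebraic for UNCOUNTABLY many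
`s`, THEN (Verdier) β holds at `t` in degree `2n`. [cite: vanGeemen1994HodgeAV, 4.9 and Lemma 5.2 (6)] [cite: Verdier1976, Cor. (5.1)]
[cite: Schoen1998HodgeWeilAddendum, §10 (proof of the Proposition)] [cite: DeligneHodgeII1971, Thm. 4.1.1] -/
theorem betaInverse_of_weilPlanes_twistedProd_of_KAction_of_verdier (hGT : Verdier1976_genericLocalTriviality) (t : ComplexPoints S) {n : ℕ}
    (hn : n + n = d) (Θ Up Um Θ' U'm U'p : complexBetti 𝒳 (2 * n))
    (hθθ : ∫[hf, t] (cupProduct (show 2 * n + 2 * n = 2 * d by omega) (𝐣[t, 2 * n] Θ) (𝐣[t, 2 * n] Θ')) = 1)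
    (hθm : ∫[hf, t] (cupProduct (show 2 * n + 2 * n = 2 * d by omega) (𝐣[t, 2 * n] Θ) (𝐣[t, 2 * n] U'm)) = 0)
    (hθp : ∫[hf, t] (cupProduct (show 2 * n + 2 * n = 2 * d by omega) (𝐣[t, 2 * n] Θ) (𝐣[t, 2 * n] U'p)) = 0)
    (hpθ : ∫[hf, t] (cupProduct (show 2 * n + 2 * n = 2 * d by omega) (𝐣[t, 2 * n] Up) (𝐣[t, 2 * n] Θ')) = 0)
    (hpm : ∫[hf, t] (cupProduct (show 2 * n + 2 * n = 2 * d by omega) (𝐣[t, 2 * n] Up) (𝐣[t, 2 * n] U'm)) = 1)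
    (hpp : ∫[hf, t] (cupProduct (show 2 * n + 2 * n = 2 * d by omega) (𝐣[t, 2 * n] Up) (𝐣[t, 2 * n] U'p)) = 0)
    (hmθ : ∫[hf, t] (cupProduct (show 2 * n + 2 * n = 2 * d by omega) (𝐣[t, 2 * n] Um) (𝐣[t, 2 * n] Θ')) = 0)
    (hmm : ∫[hf, t] (cupProduct (show 2 * n + 2 * n = 2 * d by omega) (𝐣[t, 2 * n] Um) (𝐣[t, 2 * n] U'm)) = 0)
    (hmp : ∫[hf, t] (cupProduct (show 2 * n + 2 * n = 2 * d by omega) (𝐣[t, 2 * n] Um) (𝐣[t, 2 * n] U'p)) = 1)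
    (hspan : ∀ W : complexBetti 𝒳 (2 * n), ∃ a b c : ℂ, 𝐣[t, 2 * n] W = a • 𝐣[t, 2 * n] Θ + b • 𝐣[t, 2 * n] Up + c • 𝐣[t, 2 * n] Um)
    (hΘ : ∀ s : ComplexPoints S, 𝐣[s, 2 * n] Θ ∈ algebraicClasses (fiberOver f s) n) (hΘ' : 𝐣[t, 2 * n] Θ' ∈ algebraicClasses (fiberOver f t) n)
    {dK : ℕ} (hdK : 0 < dK) (A : ComplexPoints S → AbelianVariety ℂ) (e : ∀ s, (A s).X ≅ fiberOver f s) (φ : ∀ s, A s ⟶ A s)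
    (hφ : ∀ s, φ s ≫ φ s = -(dK • 𝟙 (A s))) (Φ : ∀ s, (A s).prod (A t) ⟶ (A s).prod (A t))
    (hΦ₁ : ∀ s, Φ s ≫ Motives.AbelianVariety.fst (A s) (A t) = Motives.AbelianVariety.fst (A s) (A t) ≫ φ s)
    (hΦ₂ : ∀ s, Φ s ≫ Motives.AbelianVariety.snd (A s) (A t) = Motives.AbelianVariety.snd (A s) (A t) ≫ (-φ t))
    (Ψ : ℕ → ℕ → (𝒳 ⟶ 𝒳)) (Ψf : ∀ (s : ComplexPoints S) (x y : ℕ), fiberOver f s ⟶ fiberOver f s)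
    (hΨf : ∀ s x y, Ψf s x y ≫ fiberι f s = fiberι f s ≫ Ψ x y)
    (heΨ : ∀ s x y, (e s).hom ≫ Ψf s x y = (x • 𝟙 (A s) + y • φ s).hom.hom.hom ≫ (e s).hom)
    (hUp : complexBetti.map (e t).hom (2 * n) (𝐣[t, 2 * n] Up) ∈ weilClassesPlus (A t) (φ t) n dK)
    (hUm : complexBetti.map (e t).hom (2 * n) (𝐣[t, 2 * n] Um) ∈ weilClassesMinus (A t) (φ t) n dK)
    (hU'm : complexBetti.map (e t).hom (2 * n) (𝐣[t, 2 * n] U'm) ∈ weilClassesMinus (A t) (φ t) n dK)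
    (hU'p : complexBetti.map (e t).hom (2 * n) (𝐣[t, 2 * n] U'p) ∈ weilClassesPlus (A t) (φ t) n dK)
    (hW : ¬ {s : ComplexPoints S | weilClassesOf ((A s).prod (A t)) (Φ s) (n + n) dK ≤ algebraicClasses ((A s).prod (A t)).X (n + n)}.Countable) :
    ∃ T : complexBetti 𝒳 (2 * n + 2) →ₗ[ℂ] complexBetti 𝒳 (2 * n), IsAlgebraicCorrespondence (d + 1) (d + 1) 𝒳 𝒳 T ∧
      ∀ W, 𝐣[t, 2 * n] (T (𝐆[hf, t, 2 * n] (𝐣[t, 2 * n] W))) = 𝐣[t, 2 * n] W :=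
  betaInverse_of_weilPlanes_twistedProd_of_verdier hf hGT t hn Θ Up Um Θ' U'm U'p hθθ hθm hθp hpθ hpm hpp hmθ hmm hmp hspan hΘ hΘ' hdK A e φ hφ Φ
    hΦ₁ hΦ₂
    (fun s ↦ map_chart_fiberι_mem_weilClassesPlus_of_at hf s t Ψ (Ψf s) (Ψf t) (hΨf s) (hΨf t) (A s) (A t) (e s) (e t) (φ s) (φ t) (heΨ s) (heΨ t)
      Up hUp)
    (fun s ↦ map_chart_fiberι_mem_weilClassesMinus_of_at hf s t Ψ (Ψf s) (Ψf t) (hΨf s) (hΨf t) (A s) (A t) (e s) (e t) (φ s) (φ t) (heΨ s) (heΨ t)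
      Um hUm)
    hU'm hU'p hW

end Habitat

end Summit.HodgeConjecture.HodgeConjecture.Ring2.AbelianAll

end
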